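import Summits.AtomisticToContinuum.HydrodynamicLimit.Theorems.RelayRaceLocalityNearConstantShortTimeHLMeansPinDefs
import Summits.AtomisticToContinuum.HydrodynamicLimit.Theorems.RelayRaceLocalityNearConstantShortTimeHLMeansNecessaryFields
import Summits.AtomisticToContinuum.HydrodynamicLimit.Theorems.VitaliAmplitudeTransferAmplitudeTransferIdentification
import HarnessLib.Audit

/-!
# Crux `NearConstantShortTimeHL` (stmt-AtomisticToContinuum-12502), line `means-pin-entropy` — the second engine's dock currency

Support file for the crux `…Theses.RelayRaceLocality.NearConstantShortTimeHL`, line `means-pin-entropy` (lead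
prover-line-stmt-AtomisticToContinuum-12502-a1-0). The engine line `tilt-radius`
(`Cruxes/NearConstantShortTimeHL/Lines/tilt_radius.lean`) produces its output in the currency `MeansConvergeNC`
(convergence of the expectations of every CONSERVED one-body statistic `c₀·ρ[χ] + ⟪c, m[χ]⟫ + c₄·e[χ]`, `|c₀|, |c₄|,
‖c‖ ≤ 1`), whereas the dock of this line and the first engine (`small-tilt-domination`) use `MeansConverge` (the three
fields separately). The two currencies are EQUIVALENT by linearity; this file declares `consField`, `MeansConvergeNC` VERBATIM from the tilt-radius skeleton over a REPAIRED
`eulerVal` (the skeleton's `eulerVal` has an integral-binder precedence slip that makes its `MeansConvergeNC` false — see the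
docstring of `eulerVal`; reported on the crux item) and proves both directions
(`meansConverge_of_meansConvergeNC`, `meansConvergeNC_of_meansConverge`, registered sub-goals), so that EITHER engine
docks on the engine slot `OneMeanLowerBound` through the landed bridge `oneMeanLowerBound_of_meansConverge`.
References: H.-T. Yau, Lett. Math. Phys. 22 (1991) §2 (one-body conserved statistics of local Gibbs states).
-/

noncomputable section

namespace Summit.AtomisticToContinuum.HydrodynamicLimit.Theorems.NearConstantShortTimeHL

open scoped BigOperators ENNReal Topology RealInnerProductSpace
open MeasureTheory Set Filter
open Literature.MathematicalPhysics.KineticTheory Literature.Analysis.FluidPDE Literature.Analysis.FunctionSpaces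
open Summit.AtomisticToContinuum.HydrodynamicLimit.Theorems.AmplitudeTransfer (integral_apply_V3)




/-- A CONSERVED one-body field statistic of an `n`-particle configuration: the linear combination
`c₀·(density field) + ⟪c, momentum field⟫ + c₄·(energy field)` of the tree's three empirical fields tested against `χ`
(`χ` times a collision invariant `c₀ + c·v + c₄|v|²/2`, summed over the particles and divided by `n`; VERBATIM from `Cruxes/NearConstantShortTimeHL/Lines/tilt_radius.lean`). [cite: Yau1991, §2] -/
def consField {n : ℕ} (c₀ : ℝ) (c : V3) (c₄ : ℝ) (z : Config n (Fin 3) T3) (χ : T3 → ℝ) : ℝ :=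
  c₀ * empiricalDensityField z χ + inner ℝ c (empiricalMomentumField z χ) + c₄ * empiricalEnergyField z χ

/-- The Euler value of the conserved statistic `consField c₀ c c₄ · χ` on hydrodynamic fields `(ρ, u, θ)` (time slices):
`c₀ ∫χρ + ⟪c, ∫χρu⟫ + c₄ ∫χE(ρ,u,θ)`. REPAIRED from the tilt-radius skeleton, whose text
`c₀ * ∫ x, χ x * ρ x + inner ℝ c (…) + c₄ * ∫ x, …` parses as `c₀ * ∫ x, (χ x * ρ x + inner ℝ c (…) + c₄ * ∫ x, …)` (the
integral binder extends to the right), which makes `eulerVal 0 c c₄ = 0` and the typed `MeansConvergeNC` false (energy means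
do not tend to `0`); here the first summand is parenthesised, which is the intended statement. [cite: Yau1991, §2] -/
def eulerVal (c₀ : ℝ) (c : V3) (c₄ : ℝ) (χ : T3 → ℝ) (ρ : T3 → ℝ) (u : T3 → V3) (θ : T3 → ℝ) : ℝ :=
  (c₀ * ∫ x, χ x * ρ x) + inner ℝ c (∫ x, (χ x * ρ x) • u x) +
    c₄ * ∫ x, χ x * totalEnergyDensity (ρ x) (u x) (θ x)

/-- **C⁺ of the dock** (card `means-pin-entropy`, in the crux's own frame): `NearConstantShortTimeHL` with its
conclusion "LLN at `t`" replaced by "the EXPECTATIONS of the conserved one-body statistics at time `t` converge to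
their Euler values" (plus eventual integrability, closing the Bochner-junk trap). Prefix = the crux's, verbatim. Text VERBATIM from `Cruxes/NearConstantShortTimeHL/Lines/tilt_radius.lean` (planner-cruxplan tilt-radius), over the REPAIRED `eulerVal` (see its docstring); with the repair it is equivalent to `MeansConverge` (`meansConverge_of_meansConvergeNC`, `meansConvergeNC_of_meansConverge`). [cite: Yau1991, §2] -/
@[conjecture] def MeansConvergeNC : Prop :=
  ∃ η₀ : ℝ, 0 < η₀ ∧ ∀ M : ℝ, 0 < M → ∃ δ₀ : ℝ, 0 < δ₀ ∧ ∃ τ₀ : ℝ, 0 < τ₀ ∧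
    ∀ (a₀ θ₀ : T3 → ℝ) (u₀ : T3 → V3), Continuous a₀ → Continuous θ₀ → Continuous u₀ →
    (∀ x, 0 < a₀ x) → (∀ x, 0 < θ₀ x) → ∃ σ₀ : ℝ, 0 < σ₀ ∧ ∀ σ : ℝ, 0 < σ → σ < σ₀ →
    ∀ (ε : ℕ → ℝ) (n : ℕ → ℕ), (∀ N, 0 < ε N) → Tendsto ε atTop (nhds 0) →
    Tendsto (fun N => (n N : ℝ) * ε N ^ 3) atTop (nhds (σ ^ 3)) →
    ∀ (T : ℝ) (ρ θ : ℝ → T3 → ℝ) (u : ℝ → T3 → V3), IsHardSphereEulerSolution σ T ρ u θ →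
    (∃ (ubar : V3) (θbar : ℝ), ∀ x, |ρ 0 x - 1| ≤ δ₀ ∧ ‖u 0 x - ubar‖ ≤ δ₀ ∧ |θ 0 x - θbar| ≤ δ₀) →
    ∀ Φ : (N : ℕ) → HardSphereFlow (Torus.geometry (Fin 3)) (ε N) (n N),
    let P : (N : ℕ) → Measure (Config (n N) (Fin 3) T3) := fun N =>
      particleLaw (Φ N) (canonicalDensity (Torus.geometry (Fin 3)) (ε N) (n N) (localGibbsProfile a₀ u₀ θ₀));
    (∀ N, IsProbabilityMeasure (P N)) →
    (∀ χ : T3 → ℝ, Continuous χ → ∀ δ : ℝ, 0 < δ →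
      Tendsto (fun N => P N {z | δ < |empiricalDensityField ((Φ N).flow 0 z) χ - ∫ x, χ x * ρ 0 x|}) atTop (nhds 0) ∧
      Tendsto (fun N => P N {z | δ < ‖empiricalMomentumField ((Φ N).flow 0 z) χ - ∫ x, (χ x * ρ 0 x) • u 0 x‖})
        atTop (nhds 0) ∧
      Tendsto (fun N => P N {z | δ < |empiricalEnergyField ((Φ N).flow 0 z) χ -
        ∫ x, χ x * totalEnergyDensity (ρ 0 x) (u 0 x) (θ 0 x)|}) atTop (nhds 0)) →
    ∀ t ∈ Set.Ico 0 (min T τ₀),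
    (∀ s ∈ Set.Icc 0 t, ∀ x, ρ s x * σ ^ 3 < η₀ ∧ θ s x ≤ M ∧ M⁻¹ ≤ θ s x ∧ ‖u s x‖ ≤ M ∧
      ∀ i : Fin 3, |Torus.partialDeriv i (ρ s) x| ≤ M ∧ ‖Torus.partialDeriv i (u s) x‖ ≤ M ∧
        |Torus.partialDeriv i (θ s) x| ≤ M) →
    ∀ χ : T3 → ℝ, Continuous χ → ∀ (c₀ c₄ : ℝ) (c : V3), |c₀| ≤ 1 → |c₄| ≤ 1 → ‖c‖ ≤ 1 →
      (∀ᶠ N : ℕ in atTop, Integrable (fun z => consField c₀ c c₄ ((Φ N).flow t z) χ) (P N)) ∧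
      Tendsto (fun N : ℕ => ∫ z, consField c₀ c c₄ ((Φ N).flow t z) χ ∂(P N)) atTop
        (𝓝 (eulerVal c₀ c c₄ χ (ρ t) (u t) (θ t)))

/-! ## The two dock currencies are equivalent -/

variable {m : ℕ}

/-- The conserved statistic with coefficients `(1, 0, 0)` is the density field. [folklore] -/
theorem consField_density (z : Config m (Fin 3) T3) (χ : T3 → ℝ) : consField 1 0 0 z χ = empiricalDensityField z χ := by
  simp [consField]

/-- The conserved statistic with coefficients `(0, 0, 1)` is the energy field. [folklore] -/
theorem consField_energy (z : Config m (Fin 3) T3) (χ : T3 → ℝ) : consField 0 0 1 z χ = empiricalEnergyField z χ := by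
  simp [consField]

/-- The conserved statistic with coefficients `(0, eₗ, 0)` is the `l`-th momentum coordinate. [folklore] -/
theorem consField_momentum (z : Config m (Fin 3) T3) (χ : T3 → ℝ) (l : Fin 3) :
    consField 0 (EuclideanSpace.single l 1) 0 z χ = empiricalMomentumField z χ l := by
  simp [consField, EuclideanSpace.inner_single_left]

/-- Euler values of the three basic statistics. [folklore] -/
theorem eulerVal_basic (χ ρ θ : T3 → ℝ) (u : T3 → V3) (l : Fin 3) :
    eulerVal 1 0 0 χ ρ u θ = ∫ x, χ x * ρ x ∧
      eulerVal 0 0 1 χ ρ u θ = ∫ x, χ x * totalEnergyDensity (ρ x) (u x) (θ x) ∧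
      eulerVal 0 (EuclideanSpace.single l 1) 0 χ ρ u θ = (∫ x, (χ x * ρ x) • u x) l := by
  refine ⟨by simp [eulerVal], by simp [eulerVal], ?_⟩
  simp [eulerVal, EuclideanSpace.inner_single_left]

/-- An `ℝ³`-valued function is the sum of its coordinates times the standard basis. [folklore] -/
theorem eq_sum_apply_smul_basisFun (v : V3) : v = ∑ l, v l • EuclideanSpace.basisFun (Fin 3) ℝ l := by
  conv_lhs => rw [← (EuclideanSpace.basisFun (Fin 3) ℝ).sum_repr v]
  simp

/-- **`MeansConvergeNC → MeansConverge`**: specialise the conserved statistics to the density (`(1,0,0)`), the energy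
(`(0,0,1)`) and the momentum coordinates (`(0,eₗ,0)`), and recombine the coordinates. [folklore] -/
theorem meansConverge_of_meansConvergeNC : MeansConvergeNC → MeansConverge := by
  rintro ⟨η₀, hη₀, H⟩
  refine ⟨η₀, hη₀, fun M hM => ?_⟩
  obtain ⟨δ₀, hδ₀, τ₀, hτ₀, H1⟩ := H M hM
  refine ⟨δ₀, hδ₀, τ₀, hτ₀, fun a₀ θ₀ u₀ ha hθ hu ha0 hθ0 => ?_⟩
  obtain ⟨σ₀, hσ₀, H2⟩ := H1 a₀ θ₀ u₀ ha hθ hu ha0 hθ0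
  refine ⟨σ₀, hσ₀, ?_⟩
  intro σ hσ hσ' ε n hε hε0 hn T ρ θ u hE hnc Φ P hP h0 t ht hg χ hχ
  have HNC := H2 σ hσ hσ' ε n hε hε0 hn T ρ θ u hE hnc Φ hP h0 t ht hg χ hχ
  have hone : |(1 : ℝ)| ≤ 1 := by simp
  have hzero : |(0 : ℝ)| ≤ 1 := by simp
  have hzeroV : ‖(0 : V3)‖ ≤ 1 := by simp
  have hsingle : ∀ l : Fin 3, ‖(EuclideanSpace.single l (1 : ℝ) : V3)‖ ≤ 1 := fun l => by simp
  obtain ⟨hDi, hDT⟩ := HNC 1 0 0 hone hzero hzeroV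
  obtain ⟨hEi, hET⟩ := HNC 0 1 0 hzero hone hzeroV
  have hMl := fun l : Fin 3 => HNC 0 0 (EuclideanSpace.single l 1) hzero hzero (hsingle l)
  simp only [consField_density, consField_energy, consField_momentum] at hDi hDT hEi hET hMl
  rw [(eulerVal_basic χ (ρ t) (θ t) (u t) 0).1] at hDT
  rw [(eulerVal_basic χ (ρ t) (θ t) (u t) 0).2.1] at hET
  -- momentum: integrability of the vector field from its coordinates, convergence from the coordinates
  have hMi : ∀ᶠ N : ℕ in atTop, Integrable (fun z => empiricalMomentumField ((Φ N).flow t z) χ) (P N) := by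
    have hall : ∀ᶠ N : ℕ in atTop, ∀ l, Integrable (fun z => empiricalMomentumField ((Φ N).flow t z) χ l) (P N) :=
      eventually_all.2 fun l => (hMl l).1
    filter_upwards [hall] with N hN
    have heq : (fun z => empiricalMomentumField ((Φ N).flow t z) χ) =
        fun z => ∑ l, empiricalMomentumField ((Φ N).flow t z) χ l • EuclideanSpace.basisFun (Fin 3) ℝ l :=
      funext fun z => eq_sum_apply_smul_basisFun _
    rw [heq]
    exact integrable_finsetSum _ fun l _ => (hN l).smul_const _
  have hMT : Tendsto (fun N => ∫ z, empiricalMomentumField ((Φ N).flow t z) χ ∂(P N)) atTop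
      (𝓝 (∫ x, (χ x * ρ t x) • u t x)) := by
    refine tendsto_V3_of_apply fun l => ?_
    have h := (hMl l).2
    rw [(eulerVal_basic χ (ρ t) (θ t) (u t) l).2.2] at h
    refine h.congr' ?_
    filter_upwards [hMi] with N hN
    exact (integral_apply_V3 hN l).symm
  refine ⟨?_, hDT, hMT, hET⟩
  filter_upwards [hDi, hMi, hEi] with N h1 h2 h3
  exact ⟨h1, h2, h3⟩

/-- **`MeansConverge → MeansConvergeNC`**: a conserved statistic is a fixed linear combination of the three fields, and
so are its expectation and its Euler value. [folklore] -/
theorem meansConvergeNC_of_meansConverge : MeansConverge → MeansConvergeNC := by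
  rintro ⟨η₀, hη₀, H⟩
  refine ⟨η₀, hη₀, fun M hM => ?_⟩
  obtain ⟨δ₀, hδ₀, τ₀, hτ₀, H1⟩ := H M hM
  refine ⟨δ₀, hδ₀, τ₀, hτ₀, fun a₀ θ₀ u₀ ha hθ hu ha0 hθ0 => ?_⟩
  obtain ⟨σ₀, hσ₀, H2⟩ := H1 a₀ θ₀ u₀ ha hθ hu ha0 hθ0
  refine ⟨σ₀, hσ₀, ?_⟩
  intro σ hσ hσ' ε n hε hε0 hn T ρ θ u hE hnc Φ P hP h0 t ht hg χ hχ c₀ c₄ c _hc₀ _hc₄ _hc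
  obtain ⟨hI, hDT, hMT, hET⟩ := H2 σ hσ hσ' ε n hε hε0 hn T ρ θ u hE hnc Φ hP h0 t ht hg χ hχ
  have hint : ∀ᶠ N : ℕ in atTop, Integrable (fun z => consField c₀ c c₄ ((Φ N).flow t z) χ) (P N) := by
    filter_upwards [hI] with N hN
    exact ((hN.1.const_mul c₀).add (hN.2.1.const_inner c)).add (hN.2.2.const_mul c₄)
  refine ⟨hint, ?_⟩
  have hlim : Tendsto (fun N => c₀ * ∫ z, empiricalDensityField ((Φ N).flow t z) χ ∂(P N) +
      inner ℝ c (∫ z, empiricalMomentumField ((Φ N).flow t z) χ ∂(P N)) +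
      c₄ * ∫ z, empiricalEnergyField ((Φ N).flow t z) χ ∂(P N)) atTop
      (𝓝 (eulerVal c₀ c c₄ χ (ρ t) (u t) (θ t))) := by
    unfold eulerVal
    exact ((hDT.const_mul c₀).add (Tendsto.inner (tendsto_const_nhds (x := c)) hMT)).add (hET.const_mul c₄)
  refine hlim.congr' ?_
  filter_upwards [hI] with N hN
  obtain ⟨h1, h2, h3⟩ := hN
  have e1 : ∫ z, consField c₀ c c₄ ((Φ N).flow t z) χ ∂(P N) =
      ∫ z, (c₀ * empiricalDensityField ((Φ N).flow t z) χ + inner ℝ c (empiricalMomentumField ((Φ N).flow t z) χ)) ∂(P N) +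
        ∫ z, c₄ * empiricalEnergyField ((Φ N).flow t z) χ ∂(P N) :=
    integral_add ((h1.const_mul c₀).add (h2.const_inner c)) (h3.const_mul c₄)
  have e2 : ∫ z, (c₀ * empiricalDensityField ((Φ N).flow t z) χ + inner ℝ c (empiricalMomentumField ((Φ N).flow t z) χ)) ∂(P N) =
      ∫ z, c₀ * empiricalDensityField ((Φ N).flow t z) χ ∂(P N) + ∫ z, inner ℝ c (empiricalMomentumField ((Φ N).flow t z) χ) ∂(P N) :=
    integral_add (h1.const_mul c₀) (h2.const_inner c)
  rw [e1, e2, integral_const_mul, integral_const_mul, integral_inner h2 c]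

end Summit.AtomisticToContinuum.HydrodynamicLimit.Theorems.NearConstantShortTimeHL

end
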